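import Mathlib.Analysis.Complex.Basic
import Mathlib.Topology.Sequences
import Mathlib.Order.Filter.IsBounded
import Mathlib.Data.Nat.Nth
import Literature.Probability.LatticeModels.TriangularLattice

/-!
# Diagonal extraction of pointwise-bounded lattice fields (helper for the stub
`stub_compactnessAtOrigin`, line `liouville-local-limits`, crux `InteriorFlattening`,
stmt-CriticalPhenomena-8297)

Generic compactness bookkeeping used by the stubs S2 (`stub_compactnessAtOrigin`) and S7
(`stub_uniquenessReduction`) of the line: a sequence of complex-valued fields on a COUNTABLE index
set which is bounded at every index has a subsequence converging at every index (Tychonoff for a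
countable product of closed discs, which is first countable, hence sequentially compact), together
with the small order-theoretic facts that go with it (eventual bounds are global bounds; a sequence
with values in a finite type is constant along a strictly increasing subsequence; a strictly
increasing reindexing dominates the identity). No object of the crux appears here; the registered
sub-goal carried by this file is `extraction_subseq_tendsto` (fields on the mid-edges
`Sym2 HexVertex` of the honeycomb lattice).
-/

noncomputable section

open Filter Topology Literature.Probability.LatticeModels

namespace Summit.CriticalPhenomena.SAWScalingLimit.Theorems.InteriorFlattening.Liouville.Extraction

/-- **Diagonal extraction.** A sequence `H : ℕ → ι → ℂ` of fields on a countable index set that is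
bounded at every index has a strictly increasing subsequence converging at every index. -/
theorem exists_strictMono_tendsto {ι : Type*} [Countable ι] (H : ℕ → ι → ℂ)
    (hB : ∀ i, ∃ B : ℝ, ∀ n, ‖H n i‖ ≤ B) :
    ∃ φ : ℕ → ℕ, StrictMono φ ∧ ∃ G : ι → ℂ, ∀ i, Tendsto (fun n => H (φ n) i) atTop (𝓝 (G i)) := by
  choose B hB using hB
  have hK : IsCompact (Set.univ.pi fun i => Metric.closedBall (0 : ℂ) (B i)) :=
    isCompact_univ_pi fun i => isCompact_closedBall _ _
  have hmem : ∀ n, H n ∈ Set.univ.pi fun i => Metric.closedBall (0 : ℂ) (B i) := fun n =>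
    Set.mem_univ_pi.2 fun i => mem_closedBall_zero_iff.2 (hB i n)
  obtain ⟨G, -, φ, hφ, hG⟩ := hK.tendsto_subseq hmem
  exact ⟨φ, hφ, G, fun i => tendsto_pi_nhds.1 hG i⟩

/-- An eventually bounded real sequence is bounded. -/
theorem exists_forall_le_of_eventually {u : ℕ → ℝ} {B : ℝ} {N : ℕ} (h : ∀ n, N ≤ n → u n ≤ B) :
    ∃ B' : ℝ, ∀ n, u n ≤ B' := by
  have hb : IsBoundedUnder (· ≤ ·) atTop u := ⟨B, eventually_atTop.2 ⟨N, h⟩⟩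
  obtain ⟨B', hB'⟩ := hb.bddAbove_range
  exact ⟨B', fun n => hB' (Set.mem_range_self n)⟩

/-- **Diagonal extraction from eventual bounds**: it suffices that every coordinate be bounded
from some index on. -/
theorem exists_strictMono_tendsto_of_eventually {ι : Type*} [Countable ι] (H : ℕ → ι → ℂ)
    (hB : ∀ i, ∃ (B : ℝ) (N : ℕ), ∀ n, N ≤ n → ‖H n i‖ ≤ B) :
    ∃ φ : ℕ → ℕ, StrictMono φ ∧ ∃ G : ι → ℂ, ∀ i, Tendsto (fun n => H (φ n) i) atTop (𝓝 (G i)) := by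
  refine exists_strictMono_tendsto H fun i => ?_
  obtain ⟨B, N, h⟩ := hB i
  exact exists_forall_le_of_eventually h

/-- **Pigeonhole along a sequence**: a sequence with values in a finite type takes some value along
a strictly increasing subsequence. -/
theorem exists_strictMono_const {α : Type*} [Finite α] [Nonempty α] (f : ℕ → α) :
    ∃ (a : α) (φ : ℕ → ℕ), StrictMono φ ∧ ∀ n, f (φ n) = a := by
  obtain ⟨a, ha⟩ := Finite.exists_infinite_fiber f
  have hinf : (f ⁻¹' {a}).Infinite := Set.infinite_coe_iff.1 ha
  refine ⟨a, Nat.nth (fun n => n ∈ f ⁻¹' {a}), Nat.nth_strictMono hinf, fun n => ?_⟩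
  exact Nat.nth_mem_of_infinite hinf n

/-- A strictly increasing reindexing dominates the identity. -/
theorem le_of_strictMono {φ : ℕ → ℕ} (hφ : StrictMono φ) (n : ℕ) : n ≤ φ n := hφ.le_apply

/-- Composites of strictly increasing reindexings are strictly increasing. -/
theorem strictMono_comp {φ ψ : ℕ → ℕ} (hφ : StrictMono φ) (hψ : StrictMono ψ) :
    StrictMono (φ ∘ ψ) := hφ.comp hψ

/-- Passing a real inequality between two convergent sequences to the limit. -/
theorem le_of_tendsto_of_forall_le {u v : ℕ → ℝ} {a b : ℝ} (hu : Tendsto u atTop (𝓝 a))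
    (hv : Tendsto v atTop (𝓝 b)) (h : ∀ n, u n ≤ v n) : a ≤ b :=
  le_of_tendsto_of_tendsto' hu hv h

/-- Norms of a three-term linear combination pass to the limit. -/
theorem tendsto_norm_add₃ {u v w : ℕ → ℂ} {a b c : ℂ} (p q r : ℂ) (hu : Tendsto u atTop (𝓝 a))
    (hv : Tendsto v atTop (𝓝 b)) (hw : Tendsto w atTop (𝓝 c)) :
    Tendsto (fun n => ‖p * u n + q * v n + r * w n‖) atTop (𝓝 ‖p * a + q * b + r * c‖) :=
  ((((hu.const_mul p).add (hv.const_mul q)).add (hw.const_mul r))).norm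

/-- **Registered sub-goal** (crux item stmt-CriticalPhenomena-8297, line `liouville-local-limits`,
helper for `stub_compactnessAtOrigin`): diagonal extraction for fields on the mid-edges of the
honeycomb lattice that are bounded edge by edge. -/
theorem extraction_subseq_tendsto :
    ∀ (H : ℕ → Sym2 HexVertex → ℂ), (∀ z, ∃ B : ℝ, ∀ n, ‖H n z‖ ≤ B) →
      ∃ φ : ℕ → ℕ, StrictMono φ ∧ ∃ G : Sym2 HexVertex → ℂ,
        ∀ z, Tendsto (fun n => H (φ n) z) atTop (𝓝 (G z)) := by
  intro H hB
  exact exists_strictMono_tendsto H hB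

end Summit.CriticalPhenomena.SAWScalingLimit.Theorems.InteriorFlattening.Liouville.Extraction

end
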